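/-
Copyright (c) 2026. All rights reserved.
Released under Apache 2.0 license as described in the file LICENSE.
Authors: abc-iut cell, wave-2 seat abc-iut-L3-t11 (merge adapter: the real instance of
abc-iut-L4-t2's `GaloisPadicLog`, [AbsTopIII] Def 3.1 (iv), for `k = ℚ_p`).
-/
import Literature.AnabelianGeometry.AbsoluteAnabelian.GaloisPadicLogIntegers
import Literature.NumberTheory.Transcendental.PadicLogAlgClProofs
import Literature.IUT.LogVolume.LogSeriesEstimates
import Literature.IUT.LogVolume.UnitLogKernel
import HarnessLib

/-!
# [AbsTopIII] Def 3.1 (iv): the REAL `p`-adic logarithm `log_{ℚ̄_p}` as an instance of `GaloisPadicLog`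

S. Mochizuki, *Topics in absolute anabelian geometry III*, J. Math. Sci. Univ. Tokyo 22 (2015)
[MochizukiAbsTopIII2015], Def 3.1 (iv), manuscript p. 66: "the [`p`-adic] logarithm determines a
`Π_k`-equivariant isomorphism `log_k̄ : k~ := (𝒪_k̄^×)^pf ⥲ k̄`".

Seat abc-iut-L4-t2 typed this (`MLFGaloisModel.lean`, p405133, FROZEN) as the HYPOTHESIS STRUCTURE
`GaloisPadicLog k K` — a map `log : K → K` which on `𝒪_k̄^× = unitSubmonoid k K` is a homomorphism
(`log_mul`), `G_k`-equivariant (`log_smul`), has kernel exactly the roots of unity (`log_eq_zero_iff`), and is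
surjective onto `k̄` (`log_surjective`) — flagged `TODO-merge abc-iut-S1`. This file builds the REAL instance
for `k = ℚ_p`, `K = ℚ̄_p = PadicAlgCl p`:

  `GaloisPadicLog.ofPadicAlgCl p : GaloisPadicLog ℚ_[p] (PadicAlgCl p)`, `log := padicLogAlgCl p`,

the TREE's Iwasawa logarithm on `ℚ̄_p` (`Literature.NumberTheory.Transcendental.padicLogAlgCl`, with
`padicLogAlgCl_isIwasawaLog_holds`: homomorphism on `ℚ̄_pˣ`, the logarithmic series on principal units,
`log p = 0`, continuity, uniqueness; `algEquiv`: `Gal(ℚ̄_p/ℚ_p)`-equivariance). All four axioms are PROVED: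

* `log_mul`, `log_smul` — the tree's `IwasawaLog.log_mul` / `padicLogAlgCl_isIwasawaLog.algEquiv` (units are
  non-zero: `GaloisPadicLogIntegers.lean`, `𝒪_{ℚ̄_p}^× = {‖x‖ = 1}`);
* `log_eq_zero_iff` — **kernel = roots of unity**: `⇐` from `log (xⁿ) = n·log x`; `⇒`: a unit `x` has a
  principal-unit power `x^k` (tree `exists_norm_one_sub_pow_lt`), a `p`-power of which lies in the ball
  `‖1 − z‖ ≤ p⁻²` (abc-iut-S1's `exists_norm_one_sub_pow_le`), where the logarithmic series is injective
  (abc-iut-S1's `logSeries_injOn`, run in the complete finite extension `ℚ_p(z)`) — so `z = 1`;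
* `log_surjective` — **`log : 𝒪_{ℚ̄_p}^× → ℚ̄_p` is onto**: for `y ∈ ℚ̄_p`, `pⁿ·y` lies in the ball `‖·‖ ≤ p⁻²`
  of the complete field `ℚ_p(y)`, so `pⁿ·y = L(u)` for a principal unit `u` (abc-iut-S1's successive
  approximation `exists_logSeries_eq`, no exponential needed); a `pⁿ`-th root `v` of `u` in the algebraically
  closed `ℚ̄_p` is a unit with `log v = y`.

Scope (honest): `k = ℚ_p` only (`PadicAlgCl p` is the algebraic closure of `ℚ_p`; a general MLF base
`k ⊂ ℚ̄_p` needs the identification of `ℚ̄_p` as an algebraic closure of `k`, not done here). The one `def` is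
the instance; classical `p`-adic analysis; nothing here bears on [IUTchIII] Cor. 3.12.
-/

set_option autoImplicit false

noncomputable section

namespace Literature.AnabelianGeometry.AbsoluteAnabelian

open Polynomial
open scoped ValuativeRel
open Literature.NumberTheory.Transcendental Literature.IUT.LogVolume

variable (p : ℕ) [hp : Fact p.Prime]

/-! ## Analysis in the complete finite subextensions `ℚ_p(z) ⊆ ℚ̄_p` -/

/-- The contraction constant at radius `p⁻²`: `p⁻² · p^{1/(p−1)} < 1` for every prime `p`.
[cite: MochizukiAbsTopIII2015, Definition 3.1 (i) p.66] -/
theorem rpow_theta_two_lt_one : ((p : ℝ) ^ 2)⁻¹ * (p : ℝ) ^ (1 / ((p : ℝ) - 1)) < 1 := by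
  have hp2 : (2 : ℝ) ≤ p := by exact_mod_cast hp.out.two_le
  have hp1 : (1 : ℝ) < p := by linarith
  have hq : (p : ℝ) ^ (1 / ((p : ℝ) - 1)) ≤ (p : ℝ) ^ (1 : ℝ) := by
    apply Real.rpow_le_rpow_of_exponent_le hp1.le
    rw [div_le_one (by linarith)]; linarith
  rw [Real.rpow_one] at hq
  have hp0 : (0 : ℝ) < p := by linarith
  calc ((p : ℝ) ^ 2)⁻¹ * (p : ℝ) ^ (1 / ((p : ℝ) - 1)) ≤ ((p : ℝ) ^ 2)⁻¹ * p := by gcongr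
    _ = (p : ℝ)⁻¹ := by field_simp
    _ < 1 := inv_lt_one_of_one_lt₀ hp1

/-- **Injectivity of `log` near `1` in `ℚ̄_p`**: a principal unit `z ∈ ℚ̄_p` with `‖1 − z‖ ≤ p⁻²` and
`log_p z = 0` equals `1` (the logarithmic series is injective on that ball of the complete field `ℚ_p(z)`,
abc-iut-S1's `logSeries_injOn`; the tree identifies `log_p` with the series there).
[cite: MochizukiAbsTopIII2015, Definition 3.1 (i) p.66] -/
theorem PadicAlgCl.eq_one_of_log_eq_zero_of_norm_le {z : PadicAlgCl p}
    (hz : ‖1 - z‖ ≤ ((p : ℝ) ^ 2)⁻¹) (hlog : padicLogAlgCl p z = 0) : z = 1 := by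
  have hp1 : (1 : ℝ) < p := by exact_mod_cast hp.out.one_lt
  have hρ1 : ((p : ℝ) ^ 2)⁻¹ < 1 := inv_lt_one_of_one_lt₀ (by nlinarith)
  have hz1 : ‖1 - z‖ < 1 := hz.trans_lt hρ1
  -- the complete field `K' = ℚ_p(z)`
  set K' := IntermediateField.adjoin ℚ_[p] ({z} : Set (PadicAlgCl p)) with hK'
  haveI : FiniteDimensional ℚ_[p] K' :=
    IntermediateField.adjoin.finiteDimensional (Algebra.IsIntegral.isIntegral z)
  haveI : CompleteSpace K' := FiniteDimensional.complete ℚ_[p] K'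
  haveI : IsUltrametricDist K' := IsUltrametricDist.of_normedAlgebra ℚ_[p]
  letI : NontriviallyNormedField K' :=
    { (inferInstance : NormedField K') with
      non_trivial := ⟨algebraMap ℚ_[p] K' ((p : ℚ_[p])⁻¹), by
        change 1 < ‖algebraMap ℚ_[p] (PadicAlgCl p) ((p : ℚ_[p])⁻¹)‖
        rw [norm_algebraMap', norm_inv, Padic.norm_p, inv_inv]; exact hp1⟩ }
  set Z : K' := ⟨z, IntermediateField.mem_adjoin_simple_self ℚ_[p] z⟩ with hZ
  have hZz : (Z : PadicAlgCl p) = z := rfl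
  have hZ1 : ‖1 - Z‖ ≤ ((p : ℝ) ^ 2)⁻¹ := hz
  have hZ1' : ‖1 - (Z : PadicAlgCl p)‖ < 1 := hz1
  -- `log_p z` is the series, computed in `K'`
  have hser : ((logSeries Z : K') : PadicAlgCl p) = padicLogAlgCl p z := by
    rw [IwasawaLog.log_eq_padicLogSeriesAlgCl hz1]
    exact (IwasawaLog.hasSum_logSeries_coe K' Z hZ1').unique (IwasawaLog.hasSum_padicLogSeriesAlgCl hz1)
  have hLZ : logSeries Z = 0 := by
    have : ((logSeries Z : K') : PadicAlgCl p) = ((0 : K') : PadicAlgCl p) := by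
      rw [hser, hlog]; rfl
    exact Subtype.ext this
  have hinj := logSeries_injOn p K' (rpow_theta_two_lt_one p)
  have h1 : (1 : K') ∈ {y : K' | ‖1 - y‖ ≤ ((p : ℝ) ^ 2)⁻¹} := by simp
  have hZ' : Z = 1 := hinj hZ1 h1 (by rw [hLZ, logSeries_one])
  calc z = (Z : PadicAlgCl p) := rfl
    _ = ((1 : K') : PadicAlgCl p) := by rw [hZ']
    _ = 1 := rfl

/-- **Surjectivity of the series near `0` in `ℚ̄_p`**: every `w ∈ ℚ̄_p` with `‖w‖ ≤ p⁻²` is `log_p u` for a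
principal unit `u` with `‖1 − u‖ ≤ p⁻²` (abc-iut-S1's successive approximation `exists_logSeries_eq` in the
complete field `ℚ_p(w)`). [cite: MochizukiAbsTopIII2015, Definition 3.1 (i) p.66] -/
theorem PadicAlgCl.exists_log_eq_of_norm_le {w : PadicAlgCl p} (hw : ‖w‖ ≤ ((p : ℝ) ^ 2)⁻¹) :
    ∃ u : PadicAlgCl p, ‖1 - u‖ ≤ ((p : ℝ) ^ 2)⁻¹ ∧ padicLogAlgCl p u = w := by
  have hp1 : (1 : ℝ) < p := by exact_mod_cast hp.out.one_lt
  have hρ1 : ((p : ℝ) ^ 2)⁻¹ < 1 := inv_lt_one_of_one_lt₀ (by nlinarith)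
  set K' := IntermediateField.adjoin ℚ_[p] ({w} : Set (PadicAlgCl p)) with hK'
  haveI : FiniteDimensional ℚ_[p] K' :=
    IntermediateField.adjoin.finiteDimensional (Algebra.IsIntegral.isIntegral w)
  haveI : CompleteSpace K' := FiniteDimensional.complete ℚ_[p] K'
  haveI : IsUltrametricDist K' := IsUltrametricDist.of_normedAlgebra ℚ_[p]
  letI : NontriviallyNormedField K' :=
    { (inferInstance : NormedField K') with
      non_trivial := ⟨algebraMap ℚ_[p] K' ((p : ℚ_[p])⁻¹), by
        change 1 < ‖algebraMap ℚ_[p] (PadicAlgCl p) ((p : ℚ_[p])⁻¹)‖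
        rw [norm_algebraMap', norm_inv, Padic.norm_p, inv_inv]; exact hp1⟩ }
  set W : K' := ⟨w, IntermediateField.mem_adjoin_simple_self ℚ_[p] w⟩ with hW
  have hWn : ‖W‖ ≤ ((p : ℝ) ^ 2)⁻¹ := hw
  obtain ⟨U, hU, hLU⟩ := exists_logSeries_eq p K' (rpow_theta_two_lt_one p) hWn
  have hU1 : ‖1 - (U : PadicAlgCl p)‖ < 1 := lt_of_le_of_lt hU hρ1
  refine ⟨(U : PadicAlgCl p), hU, ?_⟩
  rw [IwasawaLog.log_eq_padicLogSeriesAlgCl hU1,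
    ← (IwasawaLog.hasSum_logSeries_coe K' U hU1).unique (IwasawaLog.hasSum_padicLogSeriesAlgCl hU1)]
  change ((logSeries U : K') : PadicAlgCl p) = (W : PadicAlgCl p)
  rw [hLU]

/-! ## The four axioms of `GaloisPadicLog` for `padicLogAlgCl` -/

/-- `log_p (x y) = log_p x + log_p y` on `𝒪_{ℚ̄_p}^×` (units are non-zero; the tree's `log_mul`).
[cite: MochizukiAbsTopIII2015, Definition 3.1 (i) p.66] -/
theorem PadicAlgCl.log_mul_of_mem_unitSubmonoid {x y : PadicAlgCl p}
    (hx : x ∈ unitSubmonoid ℚ_[p] (PadicAlgCl p)) (hy : y ∈ unitSubmonoid ℚ_[p] (PadicAlgCl p)) :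
    padicLogAlgCl p (x * y) = padicLogAlgCl p x + padicLogAlgCl p y :=
  IwasawaLog.log_mul (PadicAlgCl.ne_zero_of_mem_unitSubmonoid hx)
    (PadicAlgCl.ne_zero_of_mem_unitSubmonoid hy)

/-- `G_{ℚ_p}`-equivariance `log_p (σ x) = σ (log_p x)` on `𝒪_{ℚ̄_p}^×` (the tree's `algEquiv`).
[cite: MochizukiAbsTopIII2015, Definition 3.1 (i) p.66] -/
theorem PadicAlgCl.log_smul_of_mem_unitSubmonoid (σ : PadicAlgCl p ≃ₐ[ℚ_[p]] PadicAlgCl p)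
    {x : PadicAlgCl p} (hx : x ∈ unitSubmonoid ℚ_[p] (PadicAlgCl p)) :
    padicLogAlgCl p (σ • x) = σ • padicLogAlgCl p x := by
  rw [AlgEquiv.smul_def, AlgEquiv.smul_def]
  exact (padicLogAlgCl_isIwasawaLog_holds p).algEquiv σ (PadicAlgCl.ne_zero_of_mem_unitSubmonoid hx)

/-- **Kernel of `log_p` on `𝒪_{ℚ̄_p}^×` = the roots of unity** ("pf": the perfection kills exactly the
torsion). [cite: MochizukiAbsTopIII2015, Definition 3.1 (i) p.66] -/
theorem PadicAlgCl.log_eq_zero_iff_of_mem_unitSubmonoid {x : PadicAlgCl p}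
    (hx : x ∈ unitSubmonoid ℚ_[p] (PadicAlgCl p)) :
    padicLogAlgCl p x = 0 ↔ ∃ n : ℕ, 0 < n ∧ x ^ n = 1 := by
  have hI := padicLogAlgCl_isIwasawaLog_holds p
  have hx0 : x ≠ 0 := PadicAlgCl.ne_zero_of_mem_unitSubmonoid hx
  have hx1 : ‖x‖ = 1 := (PadicAlgCl.mem_unitSubmonoid_iff x).mp hx
  constructor
  · intro hlog
    -- a principal-unit power `x^k`
    obtain ⟨k, hk, hxk⟩ := IwasawaLog.exists_norm_one_sub_pow_lt hx1
    -- a `p`-power of it in the injectivity ball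
    have hρ : (0 : ℝ) < ((p : ℝ) ^ 2)⁻¹ := by
      have : (0 : ℝ) < p := by exact_mod_cast hp.out.pos
      positivity
    obtain ⟨N, hN⟩ := exists_norm_one_sub_pow_le p (PadicAlgCl p) hxk hρ
    have hlogz : padicLogAlgCl p ((x ^ k) ^ p ^ N) = 0 := by
      rw [← pow_mul, hI.log_pow hx0, hlog, mul_zero]
    have hz := PadicAlgCl.eq_one_of_log_eq_zero_of_norm_le p hN hlogz
    refine ⟨k * p ^ N, Nat.mul_pos hk (pow_pos hp.out.pos N), ?_⟩
    rw [pow_mul, hz]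
  · rintro ⟨n, hn, hxn⟩
    have h := hI.log_pow hx0 n
    rw [hxn, hI.log_one] at h
    have hn0 : (n : PadicAlgCl p) ≠ 0 := by
      haveI : CharZero (PadicAlgCl p) :=
        charZero_of_injective_algebraMap (algebraMap ℚ_[p] (PadicAlgCl p)).injective
      exact_mod_cast hn.ne'
    exact (mul_eq_zero.mp h.symm).resolve_left hn0

/-- **`log_p : 𝒪_{ℚ̄_p}^× → ℚ̄_p` is surjective**: scale `y` into the ball `‖·‖ ≤ p⁻²`, solve `log_p u = pⁿ y`
by successive approximation, and take a `pⁿ`-th root of `u` in the algebraically closed field `ℚ̄_p`.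
[cite: MochizukiAbsTopIII2015, Definition 3.1 (i) p.66] -/
theorem PadicAlgCl.log_surjective_unitSubmonoid (y : PadicAlgCl p) :
    ∃ x ∈ unitSubmonoid ℚ_[p] (PadicAlgCl p), padicLogAlgCl p x = y := by
  have hI := padicLogAlgCl_isIwasawaLog_holds p
  have hp1 : (1 : ℝ) < p := by exact_mod_cast hp.out.one_lt
  have hp0 : (0 : ℝ) < p := by linarith
  -- choose `n` with `‖p^n y‖ = p^{-n} ‖y‖ ≤ p^{-2}`
  have hρ : (0 : ℝ) < ((p : ℝ) ^ 2)⁻¹ := by positivity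
  obtain ⟨n, hn⟩ := exists_pow_lt_of_lt_one (div_pos hρ (by positivity : (0 : ℝ) < ‖y‖ + 1))
    (inv_lt_one_of_one_lt₀ hp1)
  have hn' : ‖y‖ * ((p : ℝ)⁻¹) ^ n ≤ ((p : ℝ) ^ 2)⁻¹ := by
    have h1 := (lt_div_iff₀ (by positivity : (0 : ℝ) < ‖y‖ + 1)).mp hn
    nlinarith [norm_nonneg y, pow_nonneg (inv_nonneg.mpr hp0.le) n]
  have hnp : ‖(p : PadicAlgCl p)‖ = (p : ℝ)⁻¹ := by
    rw [← map_natCast (algebraMap ℚ_[p] (PadicAlgCl p)) p, norm_algebraMap', Padic.norm_p]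
  have hnorm : ‖(p : PadicAlgCl p) ^ n * y‖ ≤ ((p : ℝ) ^ 2)⁻¹ := by
    rw [norm_mul, norm_pow, hnp, mul_comm]
    exact hn'
  obtain ⟨u, hu, hlogu⟩ := PadicAlgCl.exists_log_eq_of_norm_le p hnorm
  have hρ1 : ((p : ℝ) ^ 2)⁻¹ < 1 := inv_lt_one_of_one_lt₀ (by nlinarith)
  have hu1 : ‖u‖ = 1 := IwasawaLog.norm_eq_one_of_norm_one_sub_lt (hu.trans_lt hρ1)
  have hu0 : u ≠ 0 := norm_pos_iff.mp (by rw [hu1]; exact one_pos)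
  -- a `p^n`-th root of `u`
  obtain ⟨v, hv⟩ := IsAlgClosed.exists_pow_nat_eq u (pow_pos hp.out.pos n)
  have hv1 : ‖v‖ = 1 := by
    have h1 : ‖v‖ ^ p ^ n = 1 := by rw [← norm_pow, hv, hu1]
    exact (pow_eq_one_iff_of_nonneg (norm_nonneg v) (pow_pos hp.out.pos n).ne').mp h1
  have hv0 : v ≠ 0 := norm_pos_iff.mp (by rw [hv1]; exact one_pos)
  refine ⟨v, (PadicAlgCl.mem_unitSubmonoid_iff v).mpr hv1, ?_⟩
  -- `p^n · log v = log (v^{p^n}) = log u = p^n · y`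
  have h := hI.log_pow hv0 (p ^ n)
  rw [hv, hlogu] at h
  have hpn : ((p ^ n : ℕ) : PadicAlgCl p) ≠ 0 := by
    haveI : CharZero (PadicAlgCl p) :=
      charZero_of_injective_algebraMap (algebraMap ℚ_[p] (PadicAlgCl p)).injective
    exact_mod_cast (pow_pos hp.out.pos n).ne'
  have h' : ((p ^ n : ℕ) : PadicAlgCl p) * y = ((p ^ n : ℕ) : PadicAlgCl p) * padicLogAlgCl p v := by
    rw [← h]; push_cast; ring
  exact (mul_left_cancel₀ hpn h').symm

/-! ## The instance -/

/-- **The REAL `p`-adic logarithm of `ℚ̄_p` as abc-iut-L4-t2's `GaloisPadicLog ℚ_[p] (PadicAlgCl p)`**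
([AbsTopIII] Def 3.1 (iv): "`log_k̄ : k~ := (𝒪_k̄^×)^pf ⥲ k̄`, `Π_k`-equivariant"): `log := padicLogAlgCl p` (the
tree's Iwasawa logarithm); homomorphism on `𝒪_{ℚ̄_p}^×`, `G_{ℚ_p}`-equivariant, kernel = roots of unity, onto
`ℚ̄_p` — all four PROVED. This retires `TODO-merge abc-iut-S1` of `MLFGaloisModel.lean` for `k = ℚ_p` and is
a kernel-checked non-vacuity witness of the interface. [cite: MochizukiAbsTopIII2015, Definition 3.1 (iv) p.66] -/
def GaloisPadicLog.ofPadicAlgCl : GaloisPadicLog ℚ_[p] (PadicAlgCl p) where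
  log := padicLogAlgCl p
  log_mul _ hx _ hy := PadicAlgCl.log_mul_of_mem_unitSubmonoid p hx hy
  log_smul σ _ hx := PadicAlgCl.log_smul_of_mem_unitSubmonoid p σ hx
  log_eq_zero_iff _ hx := PadicAlgCl.log_eq_zero_iff_of_mem_unitSubmonoid p hx
  log_surjective y := PadicAlgCl.log_surjective_unitSubmonoid p y

/-- The logarithm of the instance is the tree's `padicLogAlgCl`. [cite: MochizukiAbsTopIII2015, Definition 3.1 (iv) p.66] -/
@[simp] theorem GaloisPadicLog.ofPadicAlgCl_log :
    (GaloisPadicLog.ofPadicAlgCl p).log = padicLogAlgCl p := rfl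

/-- Non-vacuity of abc-iut-L4-t2's interface: `GaloisPadicLog ℚ_[p] (PadicAlgCl p)` is inhabited.
[cite: MochizukiAbsTopIII2015, Definition 3.1 (iv) p.66] -/
theorem GaloisPadicLog.nonempty_padicAlgCl : Nonempty (GaloisPadicLog ℚ_[p] (PadicAlgCl p)) :=
  ⟨GaloisPadicLog.ofPadicAlgCl p⟩

/-! ## The `ℚ_p`-model of the whole container `MLFClosure` (appended) -/

/-- **A model of abc-iut-L4-t2's `MLFClosure`** ([AbsTopIII] Def 3.1 (i): "let `k` be an MLF, `k̄` an
algebraic closure of `k`"): `k := ℚ_p` with Mathlib's valuative structure — a non-archimedean local field by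
the tree's `Padic.isNonarchimedeanLocalField_holds` — and `k̄ := ℚ̄_p = PadicAlgCl p`. Together with
`GaloisPadicLog.ofPadicAlgCl` this is a kernel-checked non-vacuity witness of the Def 3.1 container.
[cite: MochizukiAbsTopIII2015, Definition 3.1 (i) p.66] -/
def MLFClosure.padic : MLFClosure.{0} :=
  { k := ℚ_[p]
    instLocal := Literature.NumberTheory.GaloisRepresentations.Padic.isNonarchimedeanLocalField_holds p
    K := PadicAlgCl p }

/-- The base field of the `ℚ_p`-model is `ℚ_p`. [cite: MochizukiAbsTopIII2015, Definition 3.1 (i) p.66] -/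
@[simp] theorem MLFClosure.padic_k : (MLFClosure.padic p).k = ℚ_[p] := rfl

/-- The algebraic closure of the `ℚ_p`-model is `ℚ̄_p = PadicAlgCl p`. [cite: MochizukiAbsTopIII2015, Definition 3.1 (i) p.66] -/
@[simp] theorem MLFClosure.padic_K : (MLFClosure.padic p).K = PadicAlgCl p := rfl

/-- **The real logarithm of the `ℚ_p`-model** ([AbsTopIII] Def 3.1 (iv)): `GaloisPadicLog.ofPadicAlgCl` read
on `MLFClosure.padic p`. [cite: MochizukiAbsTopIII2015, Definition 3.1 (iv) p.66] -/
def MLFClosure.padicLog : GaloisPadicLog (MLFClosure.padic p).k (MLFClosure.padic p).K :=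
  GaloisPadicLog.ofPadicAlgCl p

/-- Non-vacuity of Def 3.1 (i) + (iv) together: the `ℚ_p`-model carries a `GaloisPadicLog`.
[cite: MochizukiAbsTopIII2015, Definition 3.1 (iv) p.66] -/
theorem MLFClosure.nonempty_galoisPadicLog_padic :
    Nonempty (GaloisPadicLog (MLFClosure.padic p).k (MLFClosure.padic p).K) :=
  ⟨MLFClosure.padicLog p⟩

end Literature.AnabelianGeometry.AbsoluteAnabelian

end
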